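import Literature.Analysis.Complex.MaynardPrattPowerSum
import Mathlib.Analysis.Complex.AbsMax
import Mathlib.Analysis.Complex.ReImTopology
import Mathlib.Analysis.SpecialFunctions.Complex.LogDeriv
import Mathlib.Analysis.SpecialFunctions.Trigonometric.Bounds
import Mathlib.Analysis.SpecialFunctions.Trigonometric.Inverse
import Mathlib.Analysis.SpecialFunctions.Pow.Real
import Mathlib.Topology.Order.DenselyOrdered
import HarnessLib

/-!
# Proof of the Maynard–Pratt refined power-sum estimate (Lemma 11 of Maynard–Pratt 2024)

This file discharges the named fact `Literature.Analysis.Complex.MaynardPratt2024_lemma11`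
(vendored in `Literature/Analysis/Complex/MaynardPrattPowerSum.lean`):

* J. Maynard, K. Pratt, *Half-isolated zeros and zero-density estimates*, Int. Math. Res. Not.
  IMRN 2024:19, 12978–13014 = arXiv:2206.11729, **Lemma 11** (statement p. 8, proof pp. 9–10
  of the arXiv text).

## The printed proof and the road taken here

Write `f(s) = Σ_r c_r e^{s z_r}` (an entire function) and suppose `|f(t)| ≤ B^{-99}` on `[A, 2A]`.
The printed proof (pp. 9–10) has four steps:
1. replace `e^{s x_r}` (`x_r = Re z_r`) by its Taylor polynomial of degree `⌊3 log B⌋`, giving an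
   entire `f̃` of polynomial growth on the closed upper half-plane `ℍ̄` with `f̃ = f + O(B^{-100})`
   on `|s| ≤ 2A`;
2. the Poisson–Jensen (subharmonic) inequality on `ℍ̄` (their Lemma 10, proved from Jensen's
   formula on the disc, a Möbius map and dominated convergence):
   `log|f̃(iA)| ≤ (A/π) ∫ log|f̃(t)| /(t² + A²) dt`;
3. the lower bound `Re f̃(iA) ≥ 1 − O(B^{-200})`, by near-positivity of the terms with
   `Im z_r ≤ (log B)²/A` (`|arg c_r| ≤ 1/10`, `|A·Re z_r| ≤ 1/10`) and the decay `e^{-A Im z_r}` of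
   the others, the distinguished term `(z, c) = (0, 1)` contributing exactly `1`;
4. an upper bound for the Poisson integral: `−99 log B/(5π)` from `[A, 2A]` (whose harmonic
   measure seen from `iA` is `(arctan 2 − arctan 1)/π ≈ 0.102 > 1/99`), `+ log B + O(log log B)`
   from the rest of the real axis.

Step 3 is formalized verbatim (`half_le_norm_psum_I`). Mathlib (at the pinned revision) has the
maximum modulus principle on bounded domains (`Complex.norm_le_of_forall_mem_frontier_norm_le`)
but no Poisson–Jensen inequality / boundary-value theory for the half-plane, so steps 1, 2 and 4
are replaced by the classical "two-constants" form of the same harmonic-measure argument, which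
needs no integration: we apply the maximum modulus principle on the rectangle
`(−T, T) × (0, H)`, `T = 200 A log B`, `H = 100 A`, to the analytic function
`G = f · M₁ · M₂`, where
* `M₁(z) = exp(−iμ · log((z + iδ − b)/(z + iδ − a)))` with `[a, b] = [5A/4, 7A/4] ⊂ [A, 2A]`,
  `δ = A/1000`, `μπ = 99 log B`; one has `|M₁(z)| = exp(μ · θ(z + iδ))` where `θ(w) ∈ (0, π)` is
  the angle subtended by `[a, b]` at `w` (`π` times the harmonic measure of `[a, b]` in `ℍ`), so
  `|M₁| ≤ B^{99}` everywhere (absorbed by `|f| ≤ B^{-99}` on `[A, 2A]`, and by `M₂` on the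
  lateral sides), `|M₁| ≤ B^{1/5}` on the rest of the real axis, `|M₁| ≤ B^{1/4}` on the top
  side, and `|M₁(iA)| ≥ B^{3}`;
* `M₂(z) = exp(−z²/(100 A² log B))`, a Gaussian damping the horizontal growth `e^{|Re z|/(10A)}`
  of `f` (this replaces the Taylor truncation of step 1) at a cost `B^{1/4}` on the bottom and
  top sides, and making `G` tiny on the lateral sides.
The boundary bound `|G| ≤ B²` and the interior bound `|G(iA)| ≥ ½ B³` contradict each other once
`log B ≥ 20`; hence the absolute threshold `B₀ = e^{20}` (no attempt was made to optimise it).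

## Contents

* `MaynardPrattLemma11.*` — estimates for the Möbius quotient `(w − b)/(w − a)`, the weight `M₁`
  (generic parameters `a b δ μ`, then the parameters above), the Gaussian `M₂`, the power sum `f`,
  and the four boundary budgets; all functions are written out explicitly (no auxiliary
  definitions), so that this file is a pure proof;
* `MaynardPrattLemma11.main` — Lemma 11 with the explicit threshold `B ≥ e^{20}`;
* `MaynardPratt2024_lemma11_holds : MaynardPratt2024_lemma11` — the discharge.
-/

noncomputable section

open Finset Set

namespace Literature.Analysis.Complex

open _root_.Complex
open scoped _root_.Real

namespace MaynardPrattLemma11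

/-! ### Step 0. Elementary `arcsin` and `arg` bounds -/

/-- `arcsin u ≤ (π/2) u` on `[0, 1]` (concavity of `sin`; Mathlib's `Real.le_sin_mul`).
[folklore] -/
lemma arcsin_le_pi_div_two_mul {u : ℝ} (h0 : 0 ≤ u) (h1 : u ≤ 1) :
    Real.arcsin u ≤ π / 2 * u := by
  have hpi := Real.pi_pos
  rw [Real.arcsin_le_iff_le_sin ⟨by linarith, h1⟩ ⟨by nlinarith, by nlinarith⟩]
  exact Real.le_sin_mul h0 h1

/-- `u ≤ arcsin u` on `[0, 1]` (from `sin x ≤ x`). [folklore] -/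
lemma self_le_arcsin {u : ℝ} (h0 : 0 ≤ u) (h1 : u ≤ 1) : u ≤ Real.arcsin u := by
  have hpi := Real.two_le_pi
  rw [Real.le_arcsin_iff_sin_le ⟨by linarith, by linarith⟩ ⟨by linarith, h1⟩]
  exact Real.sin_le h0

/-- For `q` in the closed first quadrant, `arg q ≤ (π/2) · Im q/‖q‖`. [folklore] -/
lemma arg_le_pi_div_two_mul {q : ℂ} (hre : 0 ≤ q.re) (him : 0 ≤ q.im) :
    arg q ≤ π / 2 * (q.im / ‖q‖) := by
  rw [arg_of_re_nonneg hre]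
  exact arcsin_le_pi_div_two_mul (div_nonneg him (norm_nonneg _))
    (div_le_one_of_le₀ (im_le_norm q) (norm_nonneg _))

/-- For `q` in the closed first quadrant, `Im q/‖q‖ ≤ arg q`. [folklore] -/
lemma im_div_norm_le_arg {q : ℂ} (hre : 0 ≤ q.re) (him : 0 ≤ q.im) :
    q.im / ‖q‖ ≤ arg q := by
  rw [arg_of_re_nonneg hre]
  exact self_le_arcsin (div_nonneg him (norm_nonneg _))
    (div_le_one_of_le₀ (im_le_norm q) (norm_nonneg _))

/-! ### Step 1. The Möbius quotient `(w - b)/(w - a)`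

For real `a < b` and `Im w > 0`, the argument of `(w - b)/(w - a)` is the angle subtended by the
segment `[a, b]` at `w`, i.e. `π` times the harmonic measure of `[a, b] ⊂ ∂ℍ` at `w`. -/

/-- A point of the open upper half-plane is not real. [folklore] -/
lemma sub_ofReal_ne_zero {w : ℂ} (hw : 0 < w.im) (a : ℝ) : w - a ≠ 0 := by
  intro h
  have : (w - a).im = 0 := by rw [h]; simp
  simp at this
  linarith

/-- Imaginary part of the Möbius quotient. [folklore] -/
lemma quot_im (a b : ℝ) (w : ℂ) :
    ((w - b) / (w - a)).im = (b - a) * w.im / normSq (w - a) := by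
  simp only [div_im, sub_re, ofReal_re, sub_im, ofReal_im, sub_zero]
  ring

/-- Real part of the Möbius quotient. [folklore] -/
lemma quot_re (a b : ℝ) (w : ℂ) :
    ((w - b) / (w - a)).re = ((w.re - a) * (w.re - b) + w.im ^ 2) / normSq (w - a) := by
  simp only [div_re, sub_re, ofReal_re, sub_im, ofReal_im, sub_zero]
  ring

/-- The Möbius quotient maps the upper half-plane into itself (`a < b`). [folklore] -/
lemma quot_im_pos {a b : ℝ} (hab : a < b) {w : ℂ} (hw : 0 < w.im) :
    0 < ((w - b) / (w - a)).im := by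
  rw [quot_im]
  exact div_pos (mul_pos (sub_pos.2 hab) hw) (normSq_pos.2 (sub_ofReal_ne_zero hw a))

/-- Sign of the real part of the Möbius quotient. [folklore] -/
lemma quot_re_nonneg {a b : ℝ} {w : ℂ} (h : 0 ≤ (w.re - a) * (w.re - b) + w.im ^ 2) :
    0 ≤ ((w - b) / (w - a)).re := by
  rw [quot_re]
  exact div_nonneg h (normSq_nonneg _)

/-- `sin` of the subtended angle: `Im q/‖q‖ = (b - a)·Im w/(‖w - a‖‖w - b‖)`. [folklore] -/
lemma quot_im_div_norm (a b : ℝ) {w : ℂ} (hw : 0 < w.im) :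
    ((w - b) / (w - a)).im / ‖(w - b) / (w - a)‖ = (b - a) * w.im / (‖w - a‖ * ‖w - b‖) := by
  have ha : ‖w - (a : ℂ)‖ ≠ 0 := norm_ne_zero_iff.2 (sub_ofReal_ne_zero hw a)
  have hb : ‖w - (b : ℂ)‖ ≠ 0 := norm_ne_zero_iff.2 (sub_ofReal_ne_zero hw b)
  rw [quot_im, norm_div, normSq_eq_norm_sq]
  field_simp

/-! ### Step 2. The harmonic-measure weight `M₁`

`M₁(z) = exp(−iμ log((z + iδ − b)/(z + iδ − a)))` is analytic on `Im z > −δ` and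
`|M₁(z)| = exp(μ · angle subtended by [a, b] at z + iδ)`. -/

/-- Modulus of the weight `M₁`. [folklore] -/
lemma norm_hmW (a b δ μ : ℝ) (z : ℂ) :
    ‖exp (-I * μ * log ((z + I * δ - b) / (z + I * δ - a)))‖ =
      Real.exp (μ * arg ((z + I * δ - b) / (z + I * δ - a))) := by
  rw [norm_exp]
  congr 1
  simp [log_im]

/-- Analyticity of the weight `M₁` on `Im z > -δ`. [folklore] -/
lemma differentiableAt_hmW {a b δ μ : ℝ} (hab : a < b) {z : ℂ} (hz : -δ < z.im) :
    DifferentiableAt ℂ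
      (fun z : ℂ => exp (-I * μ * log ((z + I * δ - b) / (z + I * δ - a)))) z := by
  have him : 0 < (z + I * δ).im := by simp; linarith
  have hq : DifferentiableAt ℂ (fun w : ℂ => (w + I * δ - b) / (w + I * δ - a)) z :=
    DifferentiableAt.div (by fun_prop) (by fun_prop) (sub_ofReal_ne_zero him a)
  have hslit : (z + I * δ - b) / (z + I * δ - a) ∈ slitPlane :=
    mem_slitPlane_iff.2 (Or.inr (quot_im_pos hab him).ne')
  exact ((hq.clog hslit).const_mul (-I * μ)).cexp

/-- The trivial bound `|M₁| ≤ e^{μπ}`. [folklore] -/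
lemma norm_hmW_le_exp_pi {a b δ μ : ℝ} (hμ : 0 ≤ μ) (z : ℂ) :
    ‖exp (-I * μ * log ((z + I * δ - b) / (z + I * δ - a)))‖ ≤ Real.exp (μ * π) := by
  rw [norm_hmW]
  exact Real.exp_le_exp.2 (mul_le_mul_of_nonneg_left (arg_le_pi _) hμ)

/-- Upper bound for `|M₁(z)|` when `[a, b]` is seen from `z + iδ` under an angle `≤ π/2`
(`hre`) and at distances `≥ D₁, D₂` from the endpoints. [folklore] -/
lemma norm_hmW_le {a b δ μ D₁ D₂ : ℝ} (hab : a < b) (hμ : 0 ≤ μ) (hD₁ : 0 < D₁) (hD₂ : 0 < D₂)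
    {z : ℂ} (hz : -δ < z.im)
    (hre : 0 ≤ (z.re - a) * (z.re - b) + (z.im + δ) ^ 2)
    (h₁ : D₁ ≤ ‖z + I * δ - a‖) (h₂ : D₂ ≤ ‖z + I * δ - b‖) :
    ‖exp (-I * μ * log ((z + I * δ - b) / (z + I * δ - a)))‖ ≤
      Real.exp (μ * (π / 2 * ((b - a) * (z.im + δ) / (D₁ * D₂)))) := by
  rw [norm_hmW]
  apply Real.exp_le_exp.2 (mul_le_mul_of_nonneg_left ?_ hμ)
  have hw : 0 < (z + I * δ).im := by simp; linarith
  have hwre : (z + I * δ).re = z.re := by simp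
  have hwim : (z + I * δ).im = z.im + δ := by simp
  calc arg ((z + I * δ - b) / (z + I * δ - a))
      ≤ π / 2 * (((z + I * δ - b) / (z + I * δ - a)).im / ‖(z + I * δ - b) / (z + I * δ - a)‖) :=
        arg_le_pi_div_two_mul (quot_re_nonneg (by rw [hwre, hwim]; exact hre))
          (quot_im_pos hab hw).le
    _ = π / 2 * ((b - a) * (z.im + δ) / (‖z + I * δ - a‖ * ‖z + I * δ - b‖)) := by
        rw [quot_im_div_norm a b hw, hwim]
    _ ≤ π / 2 * ((b - a) * (z.im + δ) / (D₁ * D₂)) := by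
        apply mul_le_mul_of_nonneg_left _ (by positivity)
        apply div_le_div_of_nonneg_left (by nlinarith) (mul_pos hD₁ hD₂)
        exact mul_le_mul h₁ h₂ hD₂.le (norm_nonneg _)

/-- Lower bound for `|M₁(z)|` when `[a, b]` is seen from `z + iδ` under an angle `≤ π/2` and the
product of the distances to the endpoints is `≤ P`. [folklore] -/
lemma le_norm_hmW {a b δ μ P : ℝ} (hab : a < b) (hμ : 0 ≤ μ)
    {z : ℂ} (hz : -δ < z.im)
    (hre : 0 ≤ (z.re - a) * (z.re - b) + (z.im + δ) ^ 2)
    (h : ‖z + I * δ - a‖ * ‖z + I * δ - b‖ ≤ P) :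
    Real.exp (μ * ((b - a) * (z.im + δ) / P)) ≤
      ‖exp (-I * μ * log ((z + I * δ - b) / (z + I * δ - a)))‖ := by
  rw [norm_hmW]
  apply Real.exp_le_exp.2 (mul_le_mul_of_nonneg_left ?_ hμ)
  have hw : 0 < (z + I * δ).im := by simp; linarith
  have hwre : (z + I * δ).re = z.re := by simp
  have hwim : (z + I * δ).im = z.im + δ := by simp
  have hpos : 0 < ‖z + I * δ - a‖ * ‖z + I * δ - b‖ :=
    mul_pos (norm_pos_iff.2 (sub_ofReal_ne_zero hw a)) (norm_pos_iff.2 (sub_ofReal_ne_zero hw b))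
  calc (b - a) * (z.im + δ) / P
      ≤ (b - a) * (z.im + δ) / (‖z + I * δ - a‖ * ‖z + I * δ - b‖) :=
        div_le_div_of_nonneg_left (by nlinarith) hpos h
    _ = ((z + I * δ - b) / (z + I * δ - a)).im / ‖(z + I * δ - b) / (z + I * δ - a)‖ := by
        rw [quot_im_div_norm a b hw, hwim]
    _ ≤ arg ((z + I * δ - b) / (z + I * δ - a)) :=
        im_div_norm_le_arg (quot_re_nonneg (by rw [hwre, hwim]; exact hre))
          (quot_im_pos hab hw).le

/-! ### Step 3. The weight with the parameters of the proof

Below `M₁` is used with `[a, b] = [5A/4, 7A/4]`, `δ = A/1000`, `μ = 99ℓ/π` (`ℓ = log B`), i.e.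
`M₁(w) = exp(−i(99ℓ/π) log((w + iA/1000 − 7A/4)/(w + iA/1000 − 5A/4)))`. -/

/-- `|M₁| ≤ B^{99}` everywhere. [folklore] -/
lemma norm_W_le {A ℓ : ℝ} (hℓ : 0 ≤ ℓ) (w : ℂ) :
    ‖exp (-I * (99 * ℓ / π : ℝ) * log ((w + I * (A / 1000 : ℝ) - (7 * A / 4 : ℝ)) /
      (w + I * (A / 1000 : ℝ) - (5 * A / 4 : ℝ))))‖ ≤ Real.exp (99 * ℓ) := by
  have hμ : 0 ≤ 99 * ℓ / π := by positivity
  refine (norm_hmW_le_exp_pi hμ w).trans_eq ?_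
  congr 1
  field_simp

/-- `|M₁| ≤ B^{1/5}` on the real axis outside `(A, 2A)`. [folklore] -/
lemma norm_W_le_bottom {A ℓ : ℝ} (hA : 0 < A) (hℓ : 0 ≤ ℓ) {w : ℂ} (hw : w.im = 0)
    (hwE : w.re ≤ A ∨ 2 * A ≤ w.re) :
    ‖exp (-I * (99 * ℓ / π : ℝ) * log ((w + I * (A / 1000 : ℝ) - (7 * A / 4 : ℝ)) /
      (w + I * (A / 1000 : ℝ) - (5 * A / 4 : ℝ))))‖ ≤ Real.exp (ℓ / 5) := by
  have hμ : 0 ≤ 99 * ℓ / π := by positivity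
  have hre1 : (w + I * (A / 1000 : ℝ) - (5 * A / 4 : ℝ)).re = w.re - 5 * A / 4 := by simp
  have hre2 : (w + I * (A / 1000 : ℝ) - (7 * A / 4 : ℝ)).re = w.re - 7 * A / 4 := by simp
  have key : 99 * ℓ / π * (π / 2 * ((7 * A / 4 - 5 * A / 4) * (w.im + A / 1000) /
      (3 * A ^ 2 / 16))) ≤ ℓ / 5 := by
    rw [hw]
    have : 99 * ℓ / π * (π / 2 * ((7 * A / 4 - 5 * A / 4) * (0 + A / 1000) /
        (3 * A ^ 2 / 16))) = 99 * 16 * ℓ / 12000 := by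
      field_simp
      ring
    rw [this]
    linarith
  rcases hwE with h | h
  · have hprod : (A / 4) * (3 * A / 4) = 3 * A ^ 2 / 16 := by ring
    refine (norm_hmW_le (D₁ := A / 4) (D₂ := 3 * A / 4) (by linarith) hμ (by positivity)
      (by positivity) (by rw [hw]; linarith) (by rw [hw]; nlinarith) ?_ ?_).trans ?_
    · refine le_trans ?_ (abs_re_le_norm _)
      rw [hre1, abs_of_nonpos (by linarith)]
      linarith
    · refine le_trans ?_ (abs_re_le_norm _)
      rw [hre2, abs_of_nonpos (by linarith)]
      linarith
    · rw [hprod]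
      exact Real.exp_le_exp.2 key
  · have hprod : (3 * A / 4) * (A / 4) = 3 * A ^ 2 / 16 := by ring
    refine (norm_hmW_le (D₁ := 3 * A / 4) (D₂ := A / 4) (by linarith) hμ (by positivity)
      (by positivity) (by rw [hw]; linarith) (by rw [hw]; nlinarith) ?_ ?_).trans ?_
    · refine le_trans ?_ (abs_re_le_norm _)
      rw [hre1, abs_of_nonneg (by linarith)]
      linarith
    · refine le_trans ?_ (abs_re_le_norm _)
      rw [hre2, abs_of_nonneg (by linarith)]
      linarith
    · rw [hprod]
      exact Real.exp_le_exp.2 key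

/-- `|M₁| ≤ B^{1/4}` on the horizontal line `Im w = 100A`. [folklore] -/
lemma norm_W_le_top {A ℓ : ℝ} (hA : 0 < A) (hℓ : 0 ≤ ℓ) {w : ℂ} (hw : w.im = 100 * A) :
    ‖exp (-I * (99 * ℓ / π : ℝ) * log ((w + I * (A / 1000 : ℝ) - (7 * A / 4 : ℝ)) /
      (w + I * (A / 1000 : ℝ) - (5 * A / 4 : ℝ))))‖ ≤ Real.exp (ℓ / 4) := by
  have hμ : 0 ≤ 99 * ℓ / π := by positivity
  have him1 : (w + I * (A / 1000 : ℝ) - (5 * A / 4 : ℝ)).im = w.im + A / 1000 := by simp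
  have him2 : (w + I * (A / 1000 : ℝ) - (7 * A / 4 : ℝ)).im = w.im + A / 1000 := by simp
  have hy : 0 < w.im + A / 1000 := by rw [hw]; positivity
  refine (norm_hmW_le (D₁ := w.im + A / 1000) (D₂ := w.im + A / 1000) (by linarith) hμ hy hy
    (by rw [hw]; linarith) (by rw [hw]; nlinarith [sq_nonneg (w.re - 3 * A / 2)]) ?_ ?_).trans ?_
  · refine le_trans ?_ (abs_im_le_norm _)
    rw [him1, abs_of_pos hy]
  · refine le_trans ?_ (abs_im_le_norm _)
    rw [him2, abs_of_pos hy]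
  · apply Real.exp_le_exp.2
    rw [hw]
    have : 99 * ℓ / π * (π / 2 * ((7 * A / 4 - 5 * A / 4) * (100 * A + A / 1000) /
        ((100 * A + A / 1000) * (100 * A + A / 1000)))) = 99000 * ℓ / 400004 := by
      field_simp
      ring
    rw [this]
    linarith

/-- `|M₁(iA)| ≥ B³`. [folklore] -/
lemma exp_le_norm_W_I {A ℓ : ℝ} (hA : 0 < A) (hℓ : 0 ≤ ℓ) :
    Real.exp (3 * ℓ) ≤
      ‖exp (-I * (99 * ℓ / π : ℝ) * log ((I * A + I * (A / 1000 : ℝ) - (7 * A / 4 : ℝ)) /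
        (I * A + I * (A / 1000 : ℝ) - (5 * A / 4 : ℝ))))‖ := by
  have hμ : 0 ≤ 99 * ℓ / π := by positivity
  have h1 : ‖I * A + I * (A / 1000 : ℝ) - (5 * A / 4 : ℝ)‖ ^ 2 =
      (5 * A / 4) ^ 2 + (A + A / 1000) ^ 2 := by
    rw [Complex.sq_norm, normSq_apply]
    simp
    ring
  have h2 : ‖I * A + I * (A / 1000 : ℝ) - (7 * A / 4 : ℝ)‖ ^ 2 =
      (7 * A / 4) ^ 2 + (A + A / 1000) ^ 2 := by
    rw [Complex.sq_norm, normSq_apply]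
    simp
    ring
  have hprod : ‖I * A + I * (A / 1000 : ℝ) - (5 * A / 4 : ℝ)‖ *
      ‖I * A + I * (A / 1000 : ℝ) - (7 * A / 4 : ℝ)‖ ≤ 27 * A ^ 2 / 8 := by
    nlinarith [two_mul_le_add_sq ‖I * A + I * (A / 1000 : ℝ) - (5 * A / 4 : ℝ)‖
      ‖I * A + I * (A / 1000 : ℝ) - (7 * A / 4 : ℝ)‖]
  refine le_trans ?_ (le_norm_hmW (z := I * A) (by linarith) hμ (by simp; linarith)
    (by simp; positivity) hprod)
  apply Real.exp_le_exp.2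
  simp only [mul_im, I_re, ofReal_im, I_im, ofReal_re, mul_zero, one_mul, zero_add]
  have : 99 * ℓ / π * ((7 * A / 4 - 5 * A / 4) * (A + A / 1000) / (27 * A ^ 2 / 8)) =
      792792 * ℓ / (54000 * π) := by
    field_simp
    ring
  rw [this, le_div_iff₀ (by positivity)]
  nlinarith [Real.pi_le_four, Real.pi_pos]

/-- Analyticity of `M₁` (with the parameters of the proof) on a neighbourhood of the closed upper
half-plane. [folklore] -/
lemma differentiableAt_W {A : ℝ} (ℓ : ℝ) (hA : 0 < A) {w : ℂ} (hw : 0 ≤ w.im) :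
    DifferentiableAt ℂ (fun w : ℂ => exp (-I * (99 * ℓ / π : ℝ) *
      log ((w + I * (A / 1000 : ℝ) - (7 * A / 4 : ℝ)) /
        (w + I * (A / 1000 : ℝ) - (5 * A / 4 : ℝ))))) w :=
  differentiableAt_hmW (by linarith) (by linarith)

/-! ### Step 4. The Gaussian damping factor `M₂(w) = exp(−w²/κ)` -/

/-- Modulus of the Gaussian. [folklore] -/
lemma norm_gauss (κ : ℝ) (w : ℂ) :
    ‖exp (-w ^ 2 / κ)‖ = Real.exp ((w.im ^ 2 - w.re ^ 2) / κ) := by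
  rw [norm_exp]
  congr 1
  rw [div_ofReal_re]
  simp [sq]

/-- The Gaussian beats the horizontal exponential growth of `f` at a cost `B^{1/4}`:
`|x|/(10A) − x²/(100 ℓ A²) ≤ ℓ/4`. [folklore] -/
lemma gauss_budget {ℓ A : ℝ} (hℓ : 0 < ℓ) (hA : 0 < A) (x : ℝ) :
    |x| / (10 * A) - x ^ 2 / (100 * ℓ * A ^ 2) ≤ ℓ / 4 := by
  have key : ℓ / 4 - (|x| / (10 * A) - x ^ 2 / (100 * ℓ * A ^ 2)) =
      (|x| - 5 * ℓ * A) ^ 2 / (100 * ℓ * A ^ 2) := by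
    have hx : x ^ 2 = |x| ^ 2 := (sq_abs x).symm
    rw [hx]
    field_simp
    ring
  have : 0 ≤ (|x| - 5 * ℓ * A) ^ 2 / (100 * ℓ * A ^ 2) := by positivity
  linarith

/-! ### Step 5. The power sum `f(w) = Σ_r c_r e^{w z_r}` -/

variable {ι : Type}

/-- Growth of `f` on the closed upper half-plane: `|f(w)| ≤ B e^{|Re w|/(10A)}` (uses
`Im z_r ≥ 0`, `|Re z_r| ≤ 1/(10A)`, `Σ|c_r| ≤ B`). [cite: MaynardPratt2024, proof of Lemma 11] -/
lemma norm_psum_le {s : Finset ι} {z c : ι → ℂ} {A B : ℝ}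
    (him : ∀ r ∈ s, 0 ≤ (z r).im) (hre : ∀ r ∈ s, |(z r).re| ≤ 1 / (10 * A))
    (hsum : ∑ r ∈ s, ‖c r‖ ≤ B) {w : ℂ} (hw : 0 ≤ w.im) :
    ‖∑ r ∈ s, c r * exp (w * z r)‖ ≤ B * Real.exp (|w.re| / (10 * A)) := by
  calc ‖∑ r ∈ s, c r * exp (w * z r)‖
      ≤ ∑ r ∈ s, ‖c r * exp (w * z r)‖ := norm_sum_le _ _
    _ ≤ ∑ r ∈ s, ‖c r‖ * Real.exp (|w.re| / (10 * A)) := by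
        refine Finset.sum_le_sum fun r hr => ?_
        rw [norm_mul, norm_exp]
        refine mul_le_mul_of_nonneg_left (Real.exp_le_exp.2 ?_) (norm_nonneg _)
        rw [mul_re]
        have h1 : w.re * (z r).re ≤ |w.re| * (1 / (10 * A)) :=
          calc w.re * (z r).re ≤ |w.re * (z r).re| := le_abs_self _
            _ = |w.re| * |(z r).re| := abs_mul _ _
            _ ≤ |w.re| * (1 / (10 * A)) := mul_le_mul_of_nonneg_left (hre r hr) (abs_nonneg _)
        have h2 : 0 ≤ w.im * (z r).im := mul_nonneg hw (him r hr)
        calc w.re * (z r).re - w.im * (z r).im ≤ |w.re| * (1 / (10 * A)) := by linarith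
          _ = |w.re| / (10 * A) := by ring
    _ = (∑ r ∈ s, ‖c r‖) * Real.exp (|w.re| / (10 * A)) := by rw [Finset.sum_mul]
    _ ≤ B * Real.exp (|w.re| / (10 * A)) :=
        mul_le_mul_of_nonneg_right hsum (Real.exp_pos _).le

/-- One term of `Re f(iA)`: `Re(c_r e^{iA z_r}) ≥ −|c_r| e^{−L}` where `L/A` is the threshold
below which the near-positivity hypothesis applies (terms with `Im z_r ≤ L/A` have non-negative
real part since `|arg c_r + A Re z_r| ≤ 1/5 < π/2`; the others are damped by `e^{−A Im z_r}`).
[cite: MaynardPratt2024, proof of Lemma 11, (4.5)–(4.6)] -/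
lemma re_term_lower {A L : ℝ} (hA : 0 < A) {zr cr : ℂ} (him : 0 ≤ zr.im)
    (hre : |zr.re| ≤ 1 / (10 * A)) (harg : |zr.im| ≤ L / A → |cr.arg| ≤ 1 / 10) :
    -(‖cr‖ * Real.exp (-L)) ≤ (cr * exp (I * A * zr)).re := by
  have e1 : cr * exp (I * A * zr) = ‖cr‖ * exp (arg cr * I + I * A * zr) := by
    rw [Complex.exp_add, ← mul_assoc, norm_mul_exp_arg_mul_I]
  have e2 : (arg cr * I + I * A * zr).re = -(A * zr.im) := by simp
  have e3 : (arg cr * I + I * A * zr).im = arg cr + A * zr.re := by simp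
  have key : (cr * exp (I * A * zr)).re =
      ‖cr‖ * (Real.exp (-(A * zr.im)) * Real.cos (arg cr + A * zr.re)) := by
    rw [e1, re_ofReal_mul, exp_re, e2, e3]
  by_cases h : zr.im ≤ L / A
  · -- near-positive term
    have h1 : |cr.arg| ≤ 1 / 10 := harg (by rwa [abs_of_nonneg him])
    have h2 : |A * zr.re| ≤ 1 / 10 := by
      rw [abs_mul, abs_of_pos hA]
      calc A * |zr.re| ≤ A * (1 / (10 * A)) := mul_le_mul_of_nonneg_left hre hA.le
        _ = 1 / 10 := by field_simp
    have h3 : |arg cr + A * zr.re| ≤ 1 / 5 := (abs_add_le _ _).trans (by linarith)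
    have hcos : 0 ≤ Real.cos (arg cr + A * zr.re) := by
      apply Real.cos_nonneg_of_mem_Icc
      constructor <;> linarith [(abs_le.1 h3).1, (abs_le.1 h3).2, Real.two_le_pi]
    rw [key]
    have : 0 ≤ ‖cr‖ * (Real.exp (-(A * zr.im)) * Real.cos (arg cr + A * zr.re)) := by
      positivity
    have : 0 ≤ ‖cr‖ * Real.exp (-L) := by positivity
    linarith
  · -- damped term
    push Not at h
    have hL : L < A * zr.im := by rwa [div_lt_iff₀ hA, mul_comm] at h
    have hbound : |(cr * exp (I * A * zr)).re| ≤ ‖cr‖ * Real.exp (-L) := by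
      refine (abs_re_le_norm _).trans ?_
      rw [norm_mul, norm_exp]
      refine mul_le_mul_of_nonneg_left (Real.exp_le_exp.2 ?_) (norm_nonneg _)
      have : (I * A * zr).re = -(A * zr.im) := by simp
      rw [this]
      linarith
    exact (abs_le.1 hbound).1

/-- Step 3 of the printed proof: `|f(iA)| ≥ Re f(iA) ≥ 1 − B e^{−(log B)²} ≥ 1/2`.
[cite: MaynardPratt2024, proof of Lemma 11, (4.6)] -/
lemma half_le_norm_psum_I {s : Finset ι} {z c : ι → ℂ} {A B : ℝ} (hA : 0 < A) (hB : 0 < B)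
    (hℓ : 20 ≤ Real.log B) (hi : ∃ i ∈ s, z i = 0 ∧ c i = 1) (him : ∀ r ∈ s, 0 ≤ (z r).im)
    (hre : ∀ r ∈ s, |(z r).re| ≤ 1 / (10 * A))
    (harg : ∀ r ∈ s, |(z r).im| ≤ Real.log B ^ 2 / A → |(c r).arg| ≤ 1 / 10)
    (hsum : ∑ r ∈ s, ‖c r‖ ≤ B) :
    1 / 2 ≤ ‖∑ r ∈ s, c r * exp (I * A * z r)‖ := by
  classical
  obtain ⟨i, his, hzi, hci⟩ := hi
  set ℓ := Real.log B with hℓdef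
  have hterm : ∀ r ∈ s, -(‖c r‖ * Real.exp (-ℓ ^ 2)) ≤ (c r * exp (I * A * z r)).re :=
    fun r hr => re_term_lower hA (him r hr) (hre r hr) (harg r hr)
  have hre_sum : 1 - Real.exp (-ℓ ^ 2) * B ≤ (∑ r ∈ s, c r * exp (I * A * z r)).re := by
    rw [re_sum, ← Finset.add_sum_erase _ _ his]
    have h1 : (c i * exp (I * A * z i)).re = 1 := by simp [hzi, hci]
    rw [h1]
    have h2 : ∑ r ∈ s.erase i, -(‖c r‖ * Real.exp (-ℓ ^ 2)) ≤
        ∑ r ∈ s.erase i, (c r * exp (I * A * z r)).re :=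
      Finset.sum_le_sum fun r hr => hterm r (Finset.mem_of_mem_erase hr)
    have h3 : ∑ r ∈ s.erase i, ‖c r‖ ≤ B :=
      (Finset.sum_le_sum_of_subset_of_nonneg (Finset.erase_subset i s)
        (fun _ _ _ => norm_nonneg _)).trans hsum
    rw [Finset.sum_neg_distrib, ← Finset.sum_mul] at h2
    nlinarith [Real.exp_pos (-ℓ ^ 2)]
  have hexp : Real.exp (-ℓ ^ 2) * B ≤ 1 / 2 := by
    have hB' : B = Real.exp ℓ := (Real.exp_log hB).symm
    rw [hB', ← Real.exp_add]
    have h1 : -ℓ ^ 2 + ℓ ≤ -1 := by nlinarith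
    have h2 : Real.exp (-1) * Real.exp 1 = 1 := by rw [← Real.exp_add]; simp
    have h3 : (2 : ℝ) ≤ Real.exp 1 := by have := Real.add_one_le_exp (1 : ℝ); linarith
    have h4 : Real.exp (-ℓ ^ 2 + ℓ) ≤ Real.exp (-1) := Real.exp_le_exp.2 h1
    nlinarith [Real.exp_pos (-1)]
  calc (1 : ℝ) / 2 ≤ (∑ r ∈ s, c r * exp (I * A * z r)).re := by linarith
    _ ≤ ‖∑ r ∈ s, c r * exp (I * A * z r)‖ := re_le_norm _

/-! ### Step 6. Boundary budgets for `G = f · M₁ · M₂` on `∂((−T, T) × (0, H))`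

Here `T = 200 ℓ A`, `H = 100 A`, `κ = 100 ℓ A²`; each budget lemma bounds the sum of the three
exponents by `2ℓ` on one piece of the boundary, given the bounds of Steps 3–5. -/

/-- Multiplying the three bounds. [folklore] -/
lemma prod_le_exp {p m e₁ e₂ e₃ : ℝ} (hm0 : 0 ≤ m) (hp : p ≤ Real.exp e₁)
    (hm : m ≤ Real.exp e₂) : p * m * Real.exp e₃ ≤ Real.exp (e₁ + e₂ + e₃) := by
  rw [Real.exp_add, Real.exp_add]
  gcongr

/-- Budget on `[A, 2A]` (bottom side): `|f| ≤ B^{-99}` absorbs `|M₁| ≤ B^{99}`. [folklore] -/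
lemma budget_bottom_E {ℓ A : ℝ} (hℓ : 0 < ℓ) (hA : 0 < A) (x : ℝ) :
    -(99 * ℓ) + 99 * ℓ + ((0 : ℝ) ^ 2 - x ^ 2) / (100 * ℓ * A ^ 2) ≤ 2 * ℓ := by
  have hsq : 0 ≤ x ^ 2 / (100 * ℓ * A ^ 2) := by positivity
  have e0 : ((0 : ℝ) ^ 2 - x ^ 2) / (100 * ℓ * A ^ 2) = -(x ^ 2 / (100 * ℓ * A ^ 2)) := by ring
  rw [e0]
  linarith

/-- Budget on the rest of the bottom side: `|f| ≤ B e^{|x|/(10A)}`, `|M₁| ≤ B^{1/5}`, Gaussian.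
[folklore] -/
lemma budget_bottom_offE {ℓ A : ℝ} (hℓ : 0 < ℓ) (hA : 0 < A) (x : ℝ) :
    ℓ + |x| / (10 * A) + ℓ / 5 + ((0 : ℝ) ^ 2 - x ^ 2) / (100 * ℓ * A ^ 2) ≤ 2 * ℓ := by
  have hb := gauss_budget hℓ hA x
  have e0 : ((0 : ℝ) ^ 2 - x ^ 2) / (100 * ℓ * A ^ 2) = -(x ^ 2 / (100 * ℓ * A ^ 2)) := by ring
  rw [e0]
  linarith

/-- Budget on the top side `Im w = 100A` (needs `ℓ ≥ 20`). [folklore] -/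
lemma budget_top {ℓ A : ℝ} (hℓ : 20 ≤ ℓ) (hA : 0 < A) (x : ℝ) :
    ℓ + |x| / (10 * A) + ℓ / 4 + ((100 * A) ^ 2 - x ^ 2) / (100 * ℓ * A ^ 2) ≤ 2 * ℓ := by
  have hℓ0 : 0 < ℓ := by linarith
  have hb := gauss_budget hℓ0 hA x
  have e : ((100 * A) ^ 2 - x ^ 2) / (100 * ℓ * A ^ 2) =
      100 / ℓ - x ^ 2 / (100 * ℓ * A ^ 2) := by
    field_simp
  have h5 : 100 / ℓ ≤ 5 := by rw [div_le_iff₀ hℓ0]; linarith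
  rw [e]
  linarith

/-- Budget on the lateral sides `|Re w| = 200 ℓ A`, where the Gaussian wins. [folklore] -/
lemma budget_lateral {ℓ A y : ℝ} (hℓ : 20 ≤ ℓ) (hA : 0 < A) (h0 : 0 ≤ y) (hH : y ≤ 100 * A) :
    ℓ + 200 * ℓ * A / (10 * A) + 99 * ℓ + (y ^ 2 - (200 * ℓ * A) ^ 2) / (100 * ℓ * A ^ 2) ≤
      2 * ℓ := by
  have hℓ0 : 0 < ℓ := by linarith
  have him2 : y ^ 2 ≤ (100 * A) ^ 2 := pow_le_pow_left₀ h0 hH 2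
  have h1 : (y ^ 2 - (200 * ℓ * A) ^ 2) / (100 * ℓ * A ^ 2) ≤
      ((100 * A) ^ 2 - (200 * ℓ * A) ^ 2) / (100 * ℓ * A ^ 2) :=
    div_le_div_of_nonneg_right (by linarith) (by positivity)
  have e : ((100 * A) ^ 2 - (200 * ℓ * A) ^ 2) / (100 * ℓ * A ^ 2) = 100 / ℓ - 400 * ℓ := by
    field_simp
    ring
  have h5 : 100 / ℓ ≤ 5 := by rw [div_le_iff₀ hℓ0]; linarith
  have e2 : 200 * ℓ * A / (10 * A) = 20 * ℓ := by
    field_simp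
    ring
  rw [e2]
  rw [e] at h1
  linarith

/-! ### Step 7. Assembly: the maximum modulus principle on `(−T, T) × (0, H)` -/

/-- **Lemma 11 with the explicit threshold `B ≥ e^{20}`.**
[cite: MaynardPratt2024, Lemma 11] -/
theorem main (s : Finset ι) (z c : ι → ℂ) (A B : ℝ) (hA : 0 < A)
    (hB : Real.exp 20 ≤ B) (hi : ∃ i ∈ s, z i = 0 ∧ c i = 1) (him : ∀ r ∈ s, 0 ≤ (z r).im)
    (hre : ∀ r ∈ s, |(z r).re| ≤ 1 / (10 * A))
    (harg : ∀ r ∈ s, |(z r).im| ≤ Real.log B ^ 2 / A → |(c r).arg| ≤ 1 / 10)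
    (hsum : ∑ r ∈ s, ‖c r‖ ≤ B) :
    ∃ t ∈ Set.Icc A (2 * A), B ^ (-(99 : ℝ)) ≤ ‖∑ r ∈ s, c r * exp ((t : ℂ) * z r)‖ := by
  by_contra! hcon
  have hB0 : 0 < B := (Real.exp_pos 20).trans_le hB
  set ℓ := Real.log B with hℓdef
  have hℓ : 20 ≤ ℓ := (Real.le_log_iff_exp_le hB0).2 hB
  have hℓ0 : 0 < ℓ := by linarith
  have hBℓ : Real.exp ℓ = B := Real.exp_log hB0
  -- the hypotheses on `f` in exponential form
  have hsmall : ∀ t : ℝ, t ∈ Set.Icc A (2 * A) →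
      ‖∑ r ∈ s, c r * exp ((t : ℂ) * z r)‖ ≤ Real.exp (-(99 * ℓ)) := by
    intro t ht
    have h := (hcon t ht).le
    have e : B ^ (-(99 : ℝ)) = Real.exp (-(99 * ℓ)) := by
      rw [Real.rpow_def_of_pos hB0]
      congr 1
      ring
    rwa [e] at h
  have hgrowth : ∀ w : ℂ, 0 ≤ w.im →
      ‖∑ r ∈ s, c r * exp (w * z r)‖ ≤ Real.exp (ℓ + |w.re| / (10 * A)) := by
    intro w hw
    rw [Real.exp_add, hBℓ]
    exact norm_psum_le him hre hsum hw
  have hlow : 1 / 2 ≤ ‖∑ r ∈ s, c r * exp (I * A * z r)‖ :=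
    half_le_norm_psum_I hA hB0 hℓ hi him hre harg hsum
  -- the auxiliary function `G = f · M₁ · M₂`
  set G : ℂ → ℂ := fun w => (∑ r ∈ s, c r * exp (w * z r)) *
    exp (-I * (99 * ℓ / π : ℝ) * log ((w + I * (A / 1000 : ℝ) - (7 * A / 4 : ℝ)) /
      (w + I * (A / 1000 : ℝ) - (5 * A / 4 : ℝ)))) *
    exp (-w ^ 2 / (100 * ℓ * A ^ 2 : ℝ)) with hG
  have hGnorm : ∀ w : ℂ, ‖G w‖ = ‖∑ r ∈ s, c r * exp (w * z r)‖ *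
      ‖exp (-I * (99 * ℓ / π : ℝ) * log ((w + I * (A / 1000 : ℝ) - (7 * A / 4 : ℝ)) /
        (w + I * (A / 1000 : ℝ) - (5 * A / 4 : ℝ))))‖ *
      Real.exp ((w.im ^ 2 - w.re ^ 2) / (100 * ℓ * A ^ 2)) := by
    intro w
    rw [← norm_gauss, hG, norm_mul, norm_mul]
  have hGdiff : ∀ w : ℂ, 0 ≤ w.im → DifferentiableAt ℂ G w := by
    intro w hw
    have hf : DifferentiableAt ℂ (fun w : ℂ => ∑ r ∈ s, c r * exp (w * z r)) w := by fun_prop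
    have hg : DifferentiableAt ℂ (fun w : ℂ => exp (-w ^ 2 / (100 * ℓ * A ^ 2 : ℝ))) w := by
      fun_prop
    exact (hf.mul (differentiableAt_W ℓ hA hw)).mul hg
  -- the rectangle
  set T : ℝ := 200 * ℓ * A with hT
  set H : ℝ := 100 * A with hH
  have hT0 : 0 < T := by positivity
  have hAH : A < H := by linarith
  set U : Set ℂ := Ioo (-T) T ×ℂ Ioo 0 H with hU
  have hUo : IsOpen U := isOpen_Ioo.reProdIm isOpen_Ioo
  have hUb : Bornology.IsBounded U :=
    (Metric.isBounded_Ioo _ _).reProdIm (Metric.isBounded_Ioo _ _)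
  have hUc : closure U = Icc (-T) T ×ℂ Icc 0 H := by
    rw [hU, closure_reProdIm, closure_Ioo (by linarith), closure_Ioo (by linarith)]
  -- the boundary bound `|G| ≤ B²`
  have hfront : ∀ w ∈ frontier U, ‖G w‖ ≤ Real.exp (2 * ℓ) := by
    intro w hw
    rw [hUo.frontier_eq, hUc] at hw
    obtain ⟨hw1, hw2⟩ := hw
    rw [mem_reProdIm] at hw1
    obtain ⟨⟨hre1, hre2⟩, ⟨him1, him2⟩⟩ := hw1
    have hw2' : ¬ (w.re ∈ Ioo (-T) T ∧ w.im ∈ Ioo 0 H) := fun h => hw2 (mem_reProdIm.2 h)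
    rw [hGnorm]
    rcases him1.eq_or_lt with h0 | h0
    · -- bottom side `Im w = 0`
      rw [← h0]
      by_cases hE : A ≤ w.re ∧ w.re ≤ 2 * A
      · have hw' : ((w.re : ℝ) : ℂ) = w := Complex.ext (by simp) (by simp [← h0])
        have h1 : ‖∑ r ∈ s, c r * exp (w * z r)‖ ≤ Real.exp (-(99 * ℓ)) := by
          have := hsmall w.re hE
          rwa [hw'] at this
        exact (prod_le_exp (norm_nonneg _) h1 (norm_W_le hℓ0.le w)).trans
          (Real.exp_le_exp.2 (budget_bottom_E hℓ0 hA w.re))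
      · have hE' : w.re ≤ A ∨ 2 * A ≤ w.re := by
          rcases le_or_gt w.re A with h | h
          · exact Or.inl h
          · right
            by_contra h'
            exact hE ⟨h.le, (not_le.1 h').le⟩
        exact (prod_le_exp (norm_nonneg _) (hgrowth w (by rw [← h0]))
          (norm_W_le_bottom hA hℓ0.le h0.symm hE')).trans
            (Real.exp_le_exp.2 (budget_bottom_offE hℓ0 hA w.re))
    rcases him2.eq_or_lt with h1 | h1
    · -- top side `Im w = 100 A`
      rw [h1]
      exact (prod_le_exp (norm_nonneg _) (hgrowth w h0.le)
        (norm_W_le_top hA hℓ0.le h1)).trans (Real.exp_le_exp.2 (budget_top hℓ hA w.re))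
    -- lateral sides `|Re w| = T`
    have hwre : |w.re| = T := by
      rcases hre1.eq_or_lt with h2 | h2
      · rw [← h2, abs_neg, abs_of_pos hT0]
      rcases hre2.eq_or_lt with h3 | h3
      · rw [h3, abs_of_pos hT0]
      exact absurd ⟨⟨h2, h3⟩, h0, h1⟩ hw2'
    have hre2' : w.re ^ 2 = (200 * ℓ * A) ^ 2 := by rw [← sq_abs, hwre]
    have hg := hgrowth w h0.le
    rw [hwre] at hg
    rw [hre2']
    exact (prod_le_exp (norm_nonneg _) hg (norm_W_le hℓ0.le w)).trans
      (Real.exp_le_exp.2 (budget_lateral hℓ hA h0.le h1.le))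
  have hdiff : DiffContOnCl ℂ G U := by
    refine DifferentiableOn.diffContOnCl fun w hw => ?_
    rw [hUc, mem_reProdIm] at hw
    exact (hGdiff w hw.2.1).differentiableWithinAt
  have hIA : I * A ∈ closure U := by
    rw [hUc, mem_reProdIm]
    simp only [mul_re, I_re, ofReal_re, zero_mul, I_im, ofReal_im, mul_zero, sub_zero,
      Set.mem_Icc, mul_im, one_mul, zero_add]
    exact ⟨⟨by linarith, by linarith⟩, hA.le, hAH.le⟩
  have hmax := Complex.norm_le_of_forall_mem_frontier_norm_le hUb hdiff hfront hIA
  -- the interior lower bound `|G(iA)| ≥ ½ B³`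
  have hGlow : 1 / 2 * Real.exp (3 * ℓ) ≤ ‖G (I * A)‖ := by
    rw [hGnorm]
    have h3 : 1 ≤ Real.exp (((I * A).im ^ 2 - (I * A).re ^ 2) / (100 * ℓ * A ^ 2)) := by
      apply Real.one_le_exp
      have : ((I * A).im ^ 2 - (I * A).re ^ 2) / (100 * ℓ * A ^ 2) =
          A ^ 2 / (100 * ℓ * A ^ 2) := by
        simp
      rw [this]
      positivity
    calc 1 / 2 * Real.exp (3 * ℓ) = 1 / 2 * Real.exp (3 * ℓ) * 1 := by ring
      _ ≤ _ := mul_le_mul (mul_le_mul hlow (exp_le_norm_W_I hA hℓ0.le) (by positivity)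
          (norm_nonneg _)) h3 zero_le_one (by positivity)
  -- contradiction
  have h2e : (2 : ℝ) < Real.exp ℓ := by
    have := Real.add_one_le_exp ℓ
    linarith
  have h3ℓ : Real.exp (3 * ℓ) = Real.exp ℓ * Real.exp (2 * ℓ) := by
    rw [← Real.exp_add]
    ring_nf
  rw [h3ℓ] at hGlow
  nlinarith [Real.exp_pos (2 * ℓ), hGlow.trans hmax]

end MaynardPrattLemma11

open MaynardPrattLemma11 in
/-- **Maynard–Pratt 2024, Lemma 11** (refined power sum estimate) holds as vendored, with the
absolute threshold `B₀ = e^{20}`: proof by the harmonic-measure / maximum-modulus argument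
described in the module docstring (a reorganisation of the printed proof, pp. 9–10 of
arXiv:2206.11729, avoiding the Poisson integral). [cite: MaynardPratt2024, Lemma 11] -/
theorem MaynardPratt2024_lemma11_holds : MaynardPratt2024_lemma11 :=
  ⟨Real.exp 20, fun _ι s z c A B hA hB hi him hre harg hsum =>
    main s z c A B hA hB hi him hre harg hsum⟩

end Literature.Analysis.Complex
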